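import Mathlib
import Summits.NavierStokesRegularity.NavierStokesRegularity.Theorems.TaoLadderRungTwoBreakOneShiftWindowGlueE2
import HarnessLib

/-!
# One-shift window certificate, kernel side — part LXIV: EVERY ADMISSIBLE RUN STAYS IN THE STEP HULLS, and the
# AMPLITUDE-HULL CLAUSE `hAwin` from a comparison of the hulls with the amplitude function
# (cell harvest/h2-tao-ladder, seat p2; rung1/RUNG1-P2G16-REPORT.md §81; support for K1(1) = `NoSurvivingDSSOne`,
# stmt-NavierStokesRegularity-20205)

MODEL lattice only (the finite WINDOW system of a Tao-type averaged cascade); nothing here is a statement about the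
Navier–Stokes equations; no item is closed; nothing numerical is asserted.

* `GridCD.traj_mem_Hs_of_gridCE` — the centred C⁰ chain (part LVII `mem_start_of_gridCE`) puts a run in the start box
  `W_s` of every step at its grid time; the rough-step soundness up to an intermediate time (part XLV
  `RoughStepD.sound'`) then keeps it in the hull `Hs_s = S_s ± (Ẑ_s + η)` for every time of step `s` up to the horizon.
* `OneShiftFrame.hAwin_of_gridCE` — for the CONSTRUCTED window certificate `windowCertOfMatrix`: if every hull `Hs_s`
  read at the window coordinate `(j, k')` lies in `[−A k', A k']`, then every admissible point's full family satisfies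
  `|x_{j,k'}(σ)| ≤ A k'` on the whole flight `σ ∈ [0, τ̂ + r_τ]` — the clause `hAwin` of `T4W76R.ClausesFor` & co.,
  reduced to a finite comparison of emitted dyadics with `A` (to be evaluated in the COMPUTATIONAL lane).
-/

noncomputable section

-- the sub-problem namespace repeats the summit name by design (D-0017)
set_option linter.dupNamespace false

namespace Summit.NavierStokesRegularity.NavierStokesRegularity.Theorems

namespace DSSOneShift

open Set Finset Metric Filter Topology TopologicalSpace
open Literature.Analysis.ODE Literature.Analysis.FluidPDE Literature.Analysis.FluidPDE.TaoCascade
open Summit.NavierStokesRegularity.NavierStokesRegularity.Theorems.TaylorModelCert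
open Summit.NavierStokesRegularity.NavierStokesRegularity.Theorems.TaylorModelReadout
open Summit.NavierStokesRegularity.NavierStokesRegularity.Theorems.CertificateGlueOn

namespace GridD

variable (g : GridD)

/-- Every time of `[0, T]` with `T ≤ t_S + h_S` lies in some step `[t_s, t_s + h_s]`, `s ≤ S`.
[cite: Moore1979, §8.1 eq. (8.13) (continuation over steps); folklore] -/
theorem exists_step_of_le_horizon {T σ : ℝ} (hσ0 : 0 ≤ σ) (hσT : σ ≤ T)
    (hTS : T ≤ g.t g.S + (g.h g.S).toReal) :
    ∃ s ≤ g.S, g.t s ≤ σ ∧ σ ≤ g.t s + (g.h s).toReal := by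
  classical
  set s := Nat.findGreatest (fun s => g.t s ≤ σ) g.S with hsdef
  have hsS : s ≤ g.S := Nat.findGreatest_le _
  have hPs : g.t s ≤ σ := by
    have h0 : g.t 0 ≤ σ := by rw [GridD.t_zero]; exact hσ0
    exact Nat.findGreatest_spec (P := fun s => g.t s ≤ σ) (Nat.zero_le g.S) h0
  refine ⟨s, hsS, hPs, ?_⟩
  rcases Nat.lt_or_ge s g.S with hlt | hge
  · have hnot : ¬ g.t (s + 1) ≤ σ :=
      Nat.findGreatest_is_greatest (P := fun s => g.t s ≤ σ) (Nat.lt_succ_self s) (Nat.succ_le_of_lt hlt)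
    rw [GridD.t_succ] at hnot
    linarith
  · have hs : s = g.S := le_antisymm hsS hge
    rw [hs]
    exact hσT.trans hTS

end GridD

namespace GridCD

variable (g : GridCD)

section Sound

variable {ι : Type*} [Fintype ι] [DecidableEq ι] {κ : Type*} [Fintype κ]

/-- **EVERY RUN OF THE CENTRED GRID STAYS IN THE STEP HULLS.** Reference run `S_c` from `c ∈ P_0` and any run `S_u` from
`a ∈ W_0` of the same rough realisation on `[0, T]`, `t_S ≤ T`, all tests passed: for every step `s ≤ S` and every time
`τ ∈ [t_s, T]` with `τ ≤ t_s + h_s`, `S_u(τ) ∈ Hs_s` (the start box by part LVII `mem_start_of_gridCE`, then the rough hull by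
part XLV `RoughStepD.sound'` applied to the re-clocked run on `[0, τ − t_s]`).
[cite: KapelaZgliczynski2009, §4 Lemma 4.1; WalawskaWilczak2016, §2.2 Lemma 2; Moore1979, §8.1 eq. (8.13); cell vocabulary, harvest/h2-tao-ladder rung1/KERNEL-CHEAP-REPLAY-SPEC.md §2 (d), (h)] -/
theorem traj_mem_Hs_of_gridCE (e : ι ≃ Fin g.n) (hn : ∀ s, (g.step s).n = g.n)
    {Tc : ℕ → κ → BTerm ι} {Tf : ℝ → κ → BTerm ι} {rows : ι → List κ}
    (hRDc : ∀ s ≤ g.S, IsRTEncl (g.es e hn s) (Tc s) (Tc s) rows (g.step s).RD)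
    (hRD : ∀ s ≤ g.S, ∀ r ∈ Ico 0 (g.h s).toReal, IsRTEncl (g.es e hn s) (Tc s) (Tf (g.t s + r)) rows (g.step s).RD)
    (hstep : ∀ s ≤ g.S, g.stepOK s = true) (hinit : g.initOK = true) (hprod : ∀ s < g.S, g.prodOKE s = true)
    (hpwf : ∀ s ≤ g.S, g.pwfOK s = true) (hpsub : ∀ s ≤ g.S, g.psubOK s = true)
    (hplink : ∀ s < g.S, g.plinkOK s = true) (hwlink : ∀ s < g.S, g.wlinkOK s = true)
    {T : ℝ} (hT : g.t g.S ≤ T)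
    {c : ι → ℝ} (hc : c ∈ boxSet (boxOf e (g.P 0))) {Sc : ℝ → ι → ℝ} (hSc0 : Sc 0 = c)
    (hSc : ∀ t ∈ Icc 0 T, HasDerivWithinAt Sc (termField (Tf t) (Sc t)) (Icc 0 T) t)
    {a : ι → ℝ} (ha : a ∈ boxSet (boxOf e (g.step 0).W)) {Su : ℝ → ι → ℝ} (hSu0 : Su 0 = a)
    (hSu : ∀ t ∈ Icc 0 T, HasDerivWithinAt Su (termField (Tf t) (Su t)) (Icc 0 T) t) :
    ∀ s ≤ g.S, ∀ τ ∈ Icc (g.t s) T, τ ≤ g.t s + (g.h s).toReal → Su τ ∈ boxSet (boxOf e (g.step s).Hs) := by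
  classical
  intro s hs τ hτ hτh
  have hchk : (g.step s).check = true := by
    have := hstep s hs
    simp only [GridD.stepOK, Bool.and_eq_true, decide_eq_true_eq] at this
    exact this.1
  have hc' : (g.step s).toRoughStepD.check = true ∧ (g.step s).checkPair = true := by
    simpa [PairStepD.check, Bool.and_eq_true] using hchk
  have hh : ∀ s ≤ g.S, 0 ≤ (g.h s).toReal := fun s hs => (g.h_nonneg_and_wfW (hstep s hs)).1
  have hWu : Su (g.t s) ∈ boxSet (boxOf e (g.step s).W) :=
    (g.mem_start_of_gridCE e hn hRDc hRD hstep hinit hprod hpwf hpsub hplink hwlink hT hc hSc0 hSc ha hSu0 hSu s hs).2.1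
  have hau : Su (g.t s) ∈ boxSet (boxOf (g.es e hn s) (g.step s).W) := by rw [GridD.boxOf_es]; exact hWu
  have ht0 : 0 ≤ g.t s := g.t_nonneg fun k hk => hh k (by omega)
  obtain ⟨uc, -, -, -, -, hlast⟩ := (g.step s).toRoughStepD.sound' (g.es e hn s) (hRDc s hs) (hRD s hs) hc'.1
  have hτ' : τ - g.t s ∈ Icc 0 (g.h s).toReal := ⟨by linarith [hτ.1], by linarith⟩
  have hrun : ∀ r ∈ Icc 0 (τ - g.t s),
      HasDerivWithinAt (fun r => Su (g.t s + r)) (termField (Tf (g.t s + r)) (Su (g.t s + r))) (Icc 0 (τ - g.t s)) r :=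
    fun r hr => hasDerivWithinAt_shift (S := Su) (S' := fun t => termField (Tf t) (Su t)) hSu ht0 (by linarith [hτ.2]) hr
  have h := (hlast _ hau (τ - g.t s) hτ' (fun r => Su (g.t s + r)) (by simp) hrun (τ - g.t s) ⟨hτ'.1, le_rfl⟩).1
  have e1 : g.t s + (τ - g.t s) = τ := by ring
  simp only [e1, GridD.boxOf_es] at h
  exact h

end Sound

end GridCD

variable {m : ℕ}

namespace OneShiftFrame

variable (F : OneShiftFrame m)

section Glue

variable {ε₀ : ℝ} {α : Fin m → Fin m → Fin m → ℤ × ℤ × ℤ → ℝ} {R : ℤ → ℝ}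
variable {g : GridCD} {kd : KrawD} {e : F.SIdx ≃ Fin g.n}
variable {κ : Type*} [Fintype κ]

/-- **THE AMPLITUDE-HULL CLAUSE `hAwin` FROM THE CENTRED GRID**: with the instance facts of the row (`FrameMatch`, the
term-data triple, the box-centre start `hP0`) and the replay Booleans of the wave, IF every step hull read at a window
coordinate `(j, k')` lies in `[−A k', A k']` (`hA` — a finite comparison of emitted dyadics with `A`), THEN every
admissible point's full family of the constructed certificate obeys `|x_{j,k'}(σ)| ≤ A k'` for every window shell `k'`
and every `σ ∈ [0, τ̂ + r_τ]`.
[cite: Tao2016AveragedNS, §4 Lemma 4.1 (4.5), §5.3; KapelaZgliczynski2009, §4 Lemma 4.1; cell vocabulary, harvest/h2-tao-ladder rung1/RUNG1-P2G9-REPORT.md §37 (hAwin)] -/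
theorem hAwin_of_gridCE (hε : 0 ≤ ε₀) (hα : IsCancellingCoeff α)
    (hEb : ∀ i, |F.tubeC i (-1)| + F.tubeR (-1) ≤ F.Eb) (hEt : ∀ i, |F.tubeC i F.W| + F.tubeR F.W ≤ F.Et)
    (M : F.FrameMatch g.toGridD kd e R)
    (Tc : ℕ → κ → BTerm F.SIdx) (rows : F.SIdx → List κ) (Tf : F.Space → ℝ → κ → BTerm F.SIdx)
    (hTf : ∀ u t x, termField (Tf u t) x = F.wfieldFlat ε₀ α (F.preclampTail u) t x)
    (hRDc : ∀ s ≤ g.S, IsRTEncl (g.es e M.hn s) (Tc s) (Tc s) rows (g.step s).RD)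
    (hRD : ∀ u : F.Space, ∀ s ≤ g.S, ∀ r ∈ Ico 0 (g.h s).toReal,
      IsRTEncl (g.es e M.hn s) (Tc s) (Tf u (g.t s + r)) rows (g.step s).RD)
    (hstep : ∀ s ≤ g.S, g.stepOK s = true) (hinit : g.initOK = true) (hprod : ∀ s < g.S, g.prodOKE s = true)
    (hpwf : ∀ s ≤ g.S, g.pwfOK s = true) (hpsub : ∀ s ≤ g.S, g.psubOK s = true)
    (hplink : ∀ s < g.S, g.plinkOK s = true) (hwlink : ∀ s < g.S, g.wlinkOK s = true)
    (hP0 : (fun c : F.SIdx => F.yc c.1 ((c.2 : ℕ) : ℤ)) ∈ boxSet (boxOf e (g.P 0)))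
    (A : ℤ → ℝ)
    (hA : ∀ s ≤ g.S, ∀ c : F.SIdx, -A ((c.2 : ℕ) : ℤ) ≤ (IntervalD.aget (g.step s).Hs (e c)).lo.toReal ∧
      (IntervalD.aget (g.step s).Hs (e c)).hi.toReal ≤ A ((c.2 : ℕ) : ℤ))
    (C : F.WState × ℝ → F.WState × ℝ) (hC : ∀ r, C r = 0 → r = 0) :
    ∀ w, F.Adm w → ∀ j k', F.InWindow k' → ∀ σ ∈ Icc 0 F.τhi,
      |F.fullFamily (F.windowCertOfMatrix hε (lt_trans zero_lt_one M.hW1) hα hEb hEt C hC) w j k' σ| ≤ A k' := by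
  classical
  intro w hw j k' hk' σ hσ
  have hW1 := M.hW1
  have hn := M.hn
  have hW : 0 < F.W := lt_trans zero_lt_one hW1
  -- the run of `w` and the reference run
  set Sw := F.windowRunMap ε₀ α (F.preclampY w) (F.preclampTail w) with hSwdef
  have hSw : F.IsRunFrom ε₀ α (F.preclampY w) (F.preclampTail w) Sw := F.isRunFrom_windowRunMap hε hW hα hEb hEt hw
  have hfw : ∀ t ∈ Icc 0 F.τhi, HasDerivWithinAt (F.flatRun Sw) (termField (Tf w t) (F.flatRun Sw t)) (Icc 0 F.τhi) t := by
    intro t ht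
    have h := F.hasDerivWithinAt_flatRun hSw ht
    rwa [← hTf w t] at h
  set Sc := F.windowRunMap ε₀ α (F.preclampY (F.zeroWin w)) (F.preclampTail (F.zeroWin w)) with hScdef
  have hSc : F.IsRunFrom ε₀ α (F.preclampY (F.zeroWin w)) (F.preclampTail (F.zeroWin w)) Sc :=
    F.isRunFrom_windowRunMap hε hW hα hEb hEt (F.adm_zeroWin hw)
  have hfc : ∀ t ∈ Icc 0 F.τhi, HasDerivWithinAt (F.flatRun Sc) (termField (Tf w t) (F.flatRun Sc t)) (Icc 0 F.τhi) t := by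
    intro t ht
    have h := F.hasDerivWithinAt_flatRun hSc ht
    rwa [F.preclampTail_zeroWin, ← hTf w t] at h
  have hSc0 : F.flatRun Sc 0 = fun c : F.SIdx => F.yc c.1 ((c.2 : ℕ) : ℤ) := funext fun c => F.flatRun_zeroWin_zero hSc c
  have ha : F.flatRun Sw 0 ∈ boxSet (boxOf e (g.step 0).W) := M.hW0 _ fun c => F.abs_flatRun_zero_sub_yc_le hSw c
  -- times
  have hτc := F.τc_gt
  have hrτ := F.rτ_pos
  have htS' : g.t g.S ≤ F.τhi := M.htS.trans (by unfold τhi; linarith)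
  have hTS' : F.τhi ≤ g.t g.S + (g.h g.S).toReal := M.hTS.le
  -- the step containing `σ`
  obtain ⟨s, hs, hσs, hσh⟩ := g.exists_step_of_le_horizon hσ.1 hσ.2 hTS'
  have hmem := g.traj_mem_Hs_of_gridCE e hn hRDc (hRD w) hstep hinit hprod hpwf hpsub hplink hwlink htS' hP0 hSc0 hfc
    ha rfl hfw s hs σ ⟨hσs, hσ.2⟩ hσh
  -- facts of step `s`: the hull is a well-formed box
  have hchkS : (g.step s).check = true := by
    have := hstep s hs
    simp only [GridD.stepOK, Bool.and_eq_true, decide_eq_true_eq] at this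
    exact this.1
  have hc' : (g.step s).toRoughStepD.check = true ∧ (g.step s).checkPair = true := by
    simpa [PairStepD.check, Bool.and_eq_true] using hchkS
  have hrc' : (g.step s).toRoughStepD.centre.check = true ∧ (g.step s).toRoughStepD.checkKZ = true := by
    simpa [RoughStepD.check, Bool.and_eq_true] using hc'.1
  obtain ⟨heta, hKZ⟩ := (g.step s).toRoughStepD.of_checkKZ hrc'.2
  have hcw := (g.step s).toRoughStepD.centre.of_checkWith (by rw [← CentreStepD.check_eq]; exact hrc'.1)
  have hwfS : ∀ c < (g.step s).n, wfsD (IntervalD.aget (g.step s).S c) = true := fun c hc => (hcw.2.2.1 c hc).2.1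
  have hZ : ∀ c < (g.step s).n, 0 ≤ (RoughStepD.dget (g.step s).Zh c).toReal := fun c hc => (hKZ c hc).1
  -- the window coordinate
  obtain ⟨hk0, hkW⟩ := hk'
  have hkn : k'.toNat < F.W := by omega
  set jj : Fin F.W := ⟨k'.toNat, hkn⟩ with hjj
  have hkj : ((jj : ℕ) : ℤ) = k' := by simp [hjj]; omega
  have hx' : F.flatRun Sw σ ∈ boxSet (boxOf (g.es e hn s) (g.step s).Hs) := by rw [GridD.boxOf_es]; exact hmem
  have hcomp := (g.step s).toRoughStepD.mem_of_mem_Hs (g.es e hn s) hwfS hZ heta hx' (j, jj)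
  rw [GridD.es_val] at hcomp
  have hval : F.flatRun Sw σ (j, jj) = Sw j k' σ := by simp only [flatRun, hkj]
  rw [hval] at hcomp
  have hAc := hA s hs (j, jj)
  simp only [hkj] at hAc
  have hfull : F.fullFamily (F.windowCertOfMatrix hε (lt_trans zero_lt_one M.hW1) hα hEb hEt C hC) w j k' σ = Sw j k' σ := rfl
  have hlo : -A k' ≤ Sw j k' σ := hAc.1.trans hcomp.1
  have hhi : Sw j k' σ ≤ A k' := hcomp.2.trans hAc.2
  rw [hfull, abs_le]
  exact ⟨hlo, hhi⟩

end Glue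

end OneShiftFrame

end DSSOneShift

end Summit.NavierStokesRegularity.NavierStokesRegularity.Theorems
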